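import Summits.Ventures.CertifiedManyBodySolver.Observables.DWaveOrderParameterCeilingCells
import HarnessLib

/-!
# OP1-C in IDENTITY FORM, part 5: a certified CEILING on the Koma–Tasaki `d`-wave ORDER PARAMETER `m⋆(μ)` over a
# chemical-potential bracket — the consumer of grand-canonical one-point `μ`-cells

HONEST FRAMING: soundness / bookkeeping theorems for a CEILING route at positivity scale; a ceiling never
speaks to the presence of pairing; not a superconductivity verdict; nothing in this file is a number and NO
grand-canonical one-point certificate exists yet — the file says what one would prove. Crew hubbard-obs (D-0042),
seat hubbard-obs-p1 (`prover-hubbard-obs-p1-g11-0`), PAIRCORR-SDP §19.8. Zero compute; no definition; no named fact;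
no `sorry`.

`m⋆(μ) := dWaveOrderParameterTT' t' U μ = lim inf_{h→0⁺} lim inf_L m_{L+1}(t',U,μ,h)` (pinned-torus pair densities,
`PinningFieldPairingOrder`) `= −∂⁺_h E(μ,h)|₀ /2 =` the largest `Re ω(P₀^d)` over the translation-invariant ground states
of `H^{tt'} − μN` (`DWaveOrderParameterInfiniteVolume`, `…QuasiAverageState`). A `μ`-cover of GRAND-CANONICAL one-point
cells (part 4: cap row on `e − μ'ρ`, discharged WITHOUT the density) therefore bounds `m⋆(μ)` on the whole bracket:

* §2 `two_mul_re_expect_localPairAt_le_of_chargedCell_certificate_gc` — the pair node of a grand-canonical cell.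
* §3 `meanEnergy_sourced_grid_le_of_cell[_two]` — the grid cap holds on the cell class:
  `e^{src}_{μ',0}(ω) ≤ e(n₀) − μ'n₀ + Δ|ρ(ω) − n₀| ≤ e(n₀) − μ'n₀ + 2Δ` for every TI minimiser of `H^{tt'} − μ_c N`,
  `|μ' − μ_c| ≤ Δ`, every `n₀ ∈ [0,2)` — so a certified canonical cap `e(n₀) ≤ hi` prices the cell cap
  `ug = hi − μ'n₀ + Δ·max(n₀, 2 − n₀)` (the typist picks the best certified `(n₀, hi)` per cell).
* §4 `re_expect_localPairAt_le_of_gcCells`, `norm_expect_localPairAt_le_of_gcCells` (every TI ground state at every `μ`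
  of the bracket, any density: `|ω(P₀^d)| ≤ B`), **`dWaveOrderParameterTT'_le_of_gcCells`: `m⋆(μ) ≤ B` for all
  `μ ∈ [μlo, μhi]`**, `boxPairLRO_le_of_isErgodic_gcCells` (ergodic ground states: box pair LRO `→ |ω(P₀^d)|² ≤ B²`).
* §5 (appended) `ObsPairLROCeilingAt_of_gcCells` — the same cover also gives the registry leaf `ObsPairLROCeilingAt t' U n c'`
  (`c' ≥ B²`) when `[μlo, μhi] ⊇ [μ₋(n), μ₊(n)]`: an OP1-GC cover is a strict superset product (leaf AND `m⋆` ceiling).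

WHAT THIS IS NOT: no number; the filling-row-free program is weaker than the density-`n` one (filling rows were worth
≈ 18 % on `M` at b2+13) and the cap loosens by `Δ·max(n₀, 2 − n₀)` per cell; positivity scale either way (×10² above informative).
References: T. Koma, H. Tasaki, J. Stat. Phys. 76 (1994) 745, §1, §2.4 [KomaTasaki1994]; R. B. Griffiths, Phys. Rev.
152 (1966) 240, §II [Griffiths1966]; O. Bratteli, A. Kishimoto, D. W. Robinson, Commun. Math. Phys. 64 (1978) 41, Thm. 2
[BratteliKishimotoRobinson1978]; O. Bratteli, D. W. Robinson, *OAQSM 1* (1987) Thm. 4.3.17 [BratteliRobinsonI1987];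
D. Ruelle, *Statistical Mechanics* (1969) §3.4 [Ruelle1969].
-/

noncomputable section

namespace Summit.Ventures.CertifiedManyBodySolver.Observables

open Matrix Complex Finset Literature.MathematicalPhysics.QuantumLattice Literature.Probability.LatticeModels
open Literature.MathematicalPhysics.QuantumLattice.HubbardWave0 ThermodynamicLimit Filter Topology
open Literature.MathematicalPhysics.QuantumManyBody.StateRelaxation
open Literature.MathematicalPhysics.QuantumLattice.InfVolFermionState (TwistFlipIndex twistedFlipAct
  twistedFlipAct_density)
open scoped ComplexOrder ComplexConjugate BigOperators

/-! ### §2  The pair-amplitude node of a grand-canonical cell -/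

section GCNode

variable {ω : InfVolFermionState 2} {t' U : ℝ}

/-- **PAIR-AMPLITUDE MAX in a grand-canonical `μ'`-cell** (`Xw = −(Γ P₀^d + (Γ P₀^d)ᴴ)`): for every translation-invariant
minimiser `ω` of `H^{tt'} − μ_c N` with `|μ' − μ_c| ≤ Δ` (ANY density) obeying the grid cap `κ⁺ e^{src}_{μ',0}(ω) ≤ κ⁺ u`,
`2 Re ω(P₀^d) ≤ −(c − Σ‖aₖ‖ + (Σ_σ μ_σ)(ρ(ω)/2 − ν)) + Δ Σᵢ |ccᵢ qᵢ| Bauxᵢ`. [cite: KomaTasaki1994, §1] [cite: WangEtAl2024, §III] -/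
theorem two_mul_re_expect_localPairAt_le_of_chargedCell_certificate_gc {μc μ' Δ : ℝ}
    (hmin : ω.IsMeanEnergyMinimiser (hubbardTTPrimeSourcedInteraction 1 t' U μc dWaveFormFactor 0) 1)
    (hnear : |μ' - μc| ≤ Δ)
    {Λ Λ' : Finset (Site 2)} (hΛ : Λ ⊆ Λ') (h8 : thicken Λ 1 ⊆ Λ') (h0 : thicken ({0} : Finset (Site 2)) 1 ⊆ Λ')
    (hz : (0 : Site 2) ∈ Λ') (hP : pairRegion (insert (0 : Site 2) unitSteps) 0 ⊆ Λ')
    (κp κm u lo : ℝ) (μf : Fin 2 → ℝ) (ν : ℝ)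
    (hcap : κp * ω.meanEnergy (hubbardTTPrimeSourcedInteraction 1 t' U μ' dWaveFormFactor 0) 1 ≤ κp * u)
    (hlo : ∀ σ : InfVolFermionState 2, σ.IsTranslationInvariant → σ.density = ω.density →
      κm * lo ≤ κm * σ.meanEnergy (hubbardTTPrimeFermionInteraction 1 t' U) 1)
    {m : Type*} [Fintype m] [DecidableEq m] {Λm : Matrix m m ℂ} (hΛm : Λm.PosSemidef) (O : m → FermionOp Λ')
    {κ' : Type*} (s : Finset κ') (B : κ' → FermionOp Λ)
    (hB0 : ∀ k ∈ s, (totalNumber : FermionOp Λ) * B k - B k * totalNumber = 0)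
    {κc : Type*} (sc : Finset κc) (cc Baux : κc → ℝ) (lc : κc → List (Orb (PolySite Λ) × Bool))
    (haux : ∀ i ∈ sc, |(∑ g : TwistFlipIndex,
        ((ω.twistedFlipAct g).expect Λ' (fermionEmbed (PolySite.incl hΛ) (ladderWord (lc i)))).re) / 32| ≤ Baux i)
    {ι : Type*} (tt : Finset ι) (γ : ι → DihedralGroup 4) (wv : ι → Site 2) (fl mt : ι → Fin 2)
    (hsh : ∀ l, d4ShiftSet (γ l) (wv l) Λ ⊆ Λ') (bb : ι → ℂ) (yw : ι → List (Orb (PolySite Λ) × Bool))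
    {δ : Type*} (ah : Finset δ) (dc : δ → ℝ) (V : δ → FermionOp Λ')
    {κ'' : Type*} (w : Finset κ'') (a : κ'' → ℂ) (word : κ'' → List (Orb (PolySite Λ') × Bool))
    {ε : Type*} (kk : Finset ε) {β : Type*} [Fintype β] [DecidableEq β]
    (G : ε → Matrix β β ℂ) (hG : ∀ e ∈ kk, (G e).PosSemidef) (Bk : ε → β → FermionOp Λ) (qk sk : ε → ℝ)
    (hqk : ∀ e ∈ kk, ∀ b, (totalNumber : FermionOp Λ) * Bk e b - Bk e b * totalNumber = ((qk e : ℝ) : ℂ) • Bk e b)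
    (hsk : ∀ e ∈ kk, Δ * |qk e| ≤ sk e) {c : ℝ}
    (hcert : -(fermionEmbed (PolySite.incl hP) (localPairAt (insert (0 : Site 2) unitSteps) dWaveFormFactor 0) +
          (fermionEmbed (PolySite.incl hP) (localPairAt (insert (0 : Site 2) unitSteps) dWaveFormFactor 0))ᴴ) -
        (c : ℂ) • (1 : FermionOp Λ') -
        ∑ σ : Fin 2, ((μf σ : ℝ) : ℂ) • (nAt 0 hz σ - ((ν : ℝ) : ℂ) • (1 : FermionOp Λ')) -
        ((κp : ℝ) : ℂ) • (((u : ℝ) : ℂ) • (1 : FermionOp Λ') -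
          fermionEmbed (PolySite.incl h0)
            ((hubbardTTPrimeSourcedInteraction 1 t' U μ' dWaveFormFactor 0).meanEnergyObs 1)) -
        ((κm : ℝ) : ℂ) • (fermionEmbed (PolySite.incl h0) ((hubbardTTPrimeFermionInteraction 1 t' U).meanEnergyObs 1) -
          ((lo : ℝ) : ℂ) • (1 : FermionOp Λ')) =
      gramForm Λm O +
        (∑ k ∈ s, (pairSourceWindowHamiltonianTT' dWaveFormFactor Λ' t' U μ' 0 * fermionEmbed (PolySite.incl hΛ) (B k) -
            fermionEmbed (PolySite.incl hΛ) (B k) * pairSourceWindowHamiltonianTT' dWaveFormFactor Λ' t' U μ' 0) +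
          ∑ i ∈ sc, ((cc i : ℝ) : ℂ) •
            (pairSourceWindowHamiltonianTT' dWaveFormFactor Λ' t' U μ' 0 *
                fermionEmbed (PolySite.incl hΛ) (ladderWord (lc i)) -
              fermionEmbed (PolySite.incl hΛ) (ladderWord (lc i)) *
                pairSourceWindowHamiltonianTT' dWaveFormFactor Λ' t' U μ' 0) +
          ∑ l ∈ tt, bb l • (gaugePhase (twistFlipExp (γ l) (fl l) (mt l)) (yw l) •
              fermionEmbed (PolySite.incl (hsh l))
                (fermionEmbed (PolySite.d4Emb (γ l) (wv l) Λ) (spinSwapIter (fl l).val (ladderWord (yw l)))) -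
            fermionEmbed (PolySite.incl hΛ) (ladderWord (yw l)))) +
        (∑ m' ∈ ah, ((dc m' : ℝ) : ℂ) • ((V m')ᴴ - V m') + ∑ k ∈ w, a k • ladderWord (word k)) +
        ∑ e ∈ kk, (kktForm (pairSourceWindowHamiltonianTT' dWaveFormFactor Λ' t' U μ' 0) (G e)
            (fun b => fermionEmbed (PolySite.incl hΛ) (Bk e b)) +
          ((sk e : ℝ) : ℂ) • gramForm (G e) (fun b => fermionEmbed (PolySite.incl hΛ) (Bk e b)))) :
    2 * (ω.expect (pairRegion (insert (0 : Site 2) unitSteps) 0)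
        (localPairAt (insert (0 : Site 2) unitSteps) dWaveFormFactor 0)).re ≤
      -(c - ∑ k ∈ w, ‖a k‖ + (∑ σ : Fin 2, μf σ) * (ω.density / 2 - ν)) +
        Δ * ∑ i ∈ sc, |cc i * (ladderCharge (lc i) : ℝ)| * Baux i := by
  have hmain := re_sum_twistedFlipAct_expect_ge_of_chargedCell_certificate_gc hmin hnear hΛ h8 h0 hz _ κp κm u lo μf ν
    hcap hlo hΛm O s B hB0 sc cc Baux lc haux tt γ wv fl mt hsh bb yw ah dc V w a word kk G hG Bk qk sk hqk hsk hcert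
  simp_rw [map_neg, Complex.neg_re, (ω.twistedFlipAct _).re_expect_fermionEmbed_localPairAt_add_conjTranspose hP,
    Finset.sum_neg_distrib, ← Finset.mul_sum, ω.sum_re_expect_localPairAt_dWave_twistedFlipAct] at hmain
  linarith

/-! ### §3  Cap discharge on the class WITHOUT the density -/

/-- **The grid cap of a grand-canonical cell holds on the whole cell class.** `U ≥ 0`; if `ω` is a translation-invariant
minimiser of `H^{tt'} − μ_c N` with `|μ' − μ_c| ≤ Δ` then for every density `n₀ ∈ [0, 2)`:
`e^{src}_{μ',0}(ω) = e^{tt'}(ω) − μ' ρ(ω) ≤ e(n₀) − μ' n₀ + Δ·|ρ(ω) − n₀|`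
(`e^{tt'}(ω) − μ_c ρ(ω) = e_GC(μ_c) ≤ e(n₀) − μ_c n₀`). [cite: Ruelle1969, §3.4] [cite: BratteliKishimotoRobinson1978, Thm. 2 (condition 2)] -/
theorem meanEnergy_sourced_grid_le_of_cell {t' U μc μ' Δ : ℝ} (hU : 0 ≤ U) {ω : InfVolFermionState 2}
    (hmin : ω.IsMeanEnergyMinimiser (hubbardTTPrimeSourcedInteraction 1 t' U μc dWaveFormFactor 0) 1)
    (hnear : |μ' - μc| ≤ Δ) {n₀ : ℝ} (hn0 : 0 ≤ n₀) (hn2 : n₀ < 2) :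
    ω.meanEnergy (hubbardTTPrimeSourcedInteraction 1 t' U μ' dWaveFormFactor 0) 1 ≤
      energyDensityTT' 1 t' U n₀ - μ' * n₀ + Δ * |ω.density - n₀| := by
  have hmin0 : ω.IsMeanEnergyMinimiser (hubbardTTPrimeMuInteraction 1 t' U μc) 1 := by
    rw [← hubbardTTPrimeSourcedInteraction_zero_source 1 t' U μc dWaveFormFactor]; exact hmin
  have h1 := hmin0.meanEnergy_eq
  have h2 := FermionInteraction.tiGroundEnergyDensity_hubbardTTPrimeMu_le_energyDensityTT'_sub 1 t' hU μc hn0 hn2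
  rw [InfVolFermionState.meanEnergy_hubbardTTPrimeMu] at h1
  rw [InfVolFermionState.meanEnergy_hubbardTTPrimeSourced, zero_mul, sub_zero]
  have h3 : (μc - μ') * (ω.density - n₀) ≤ Δ * |ω.density - n₀| := by
    have := abs_mul (μc - μ') (ω.density - n₀)
    have hle := le_abs_self ((μc - μ') * (ω.density - n₀))
    rw [abs_sub_comm] at hnear
    nlinarith [mul_le_mul_of_nonneg_right hnear (abs_nonneg (ω.density - n₀)), abs_nonneg (μc - μ')]
  nlinarith [h1, h2, h3]

/-- **Universal density window**: with `ρ(ω) ∈ [0, 2]` and `n₀ ∈ [0, 2)`, `|ρ(ω) − n₀| ≤ max(n₀, 2 − n₀)`, so the cap of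
`meanEnergy_sourced_grid_le_of_cell` is at most `e(n₀) − μ' n₀ + Δ·max(n₀, 2 − n₀)` (`≤ … + 2Δ`). [cite: Ruelle1969, §3.4] -/
theorem meanEnergy_sourced_grid_le_of_cell_max {t' U μc μ' Δ : ℝ} (hU : 0 ≤ U) {ω : InfVolFermionState 2}
    (hmin : ω.IsMeanEnergyMinimiser (hubbardTTPrimeSourcedInteraction 1 t' U μc dWaveFormFactor 0) 1)
    (hnear : |μ' - μc| ≤ Δ) {n₀ : ℝ} (hn0 : 0 ≤ n₀) (hn2 : n₀ < 2) :
    ω.meanEnergy (hubbardTTPrimeSourcedInteraction 1 t' U μ' dWaveFormFactor 0) 1 ≤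
      energyDensityTT' 1 t' U n₀ - μ' * n₀ + Δ * max n₀ (2 - n₀) := by
  have h := meanEnergy_sourced_grid_le_of_cell hU hmin hnear hn0 hn2
  have hΔ : 0 ≤ Δ := (abs_nonneg _).trans hnear
  have hρ : |ω.density - n₀| ≤ max n₀ (2 - n₀) :=
    abs_le.2 ⟨by linarith [ω.density_nonneg, le_max_left n₀ (2 - n₀)],
      by linarith [ω.density_le_two, le_max_right n₀ (2 - n₀)]⟩
  nlinarith [mul_le_mul_of_nonneg_left hρ hΔ]

end GCNode

/-! ### §4  The consumers: `Re`, modulus, the ORDER PARAMETER `m⋆(μ)`, ergodic pair LRO -/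

section GCConsumers

/-- **Grand-canonical cells ⇒ `Re ω(P₀^d) ≤ B` for EVERY translation-invariant ground state of `H^{tt'} − μN`, `μ` in the
covered bracket, ANY density.** `U ≥ 0`; cells `j` (grid points `μg j`, half-widths `Δg j`) covering `[μlo, μhi]`;
per-cell certified canonical caps `e(n₀ j) ≤ hi j` (`n₀ j ∈ [0,2)`, the typist's best choice) pricing the cell caps
`ug j ≥ hi j − μg j·n₀ j + Δg j·max(n₀ j, 2 − n₀ j)`; grand-canonical cell sentences «every TI minimiser of `H^{tt'} − μ_c N`, `|μg j − μ_c| ≤ Δg j`, with `e^{src}_{μg j,0} ≤ ug j` has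
`Re ω(P₀^d) ≤ M j`» (`two_mul_re_expect_localPairAt_le_of_chargedCell_certificate_gc`); `M j ≤ B`.
[cite: BratteliKishimotoRobinson1978, Thm. 2 (p. 47)] [cite: KomaTasaki1994, §1] -/
theorem re_expect_localPairAt_le_of_gcCells {tp U : ℝ} (hU : 0 ≤ U) {μlo μhi : ℝ}
    {J : Type*} (cells : Finset J) (μg Δg ug M n₀ hi : J → ℝ) (hn0 : ∀ j ∈ cells, 0 ≤ n₀ j)
    (hn2 : ∀ j ∈ cells, n₀ j < 2) (hhi : ∀ j ∈ cells, energyDensityTT' 1 tp U (n₀ j) ≤ hi j)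
    (hcover : ∀ μ ∈ Set.Icc μlo μhi, ∃ j ∈ cells, |μg j - μ| ≤ Δg j)
    (hug : ∀ j ∈ cells, hi j - μg j * n₀ j + Δg j * max (n₀ j) (2 - n₀ j) ≤ ug j)
    (hcell : ∀ j ∈ cells, ∀ μc : ℝ, |μg j - μc| ≤ Δg j → ∀ ω : InfVolFermionState 2,
      ω.IsMeanEnergyMinimiser (hubbardTTPrimeSourcedInteraction 1 tp U μc dWaveFormFactor 0) 1 →
      ω.meanEnergy (hubbardTTPrimeSourcedInteraction 1 tp U (μg j) dWaveFormFactor 0) 1 ≤ ug j →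
        (ω.expect (pairRegion (insert (0 : Site 2) unitSteps) 0)
          (localPairAt (insert (0 : Site 2) unitSteps) dWaveFormFactor 0)).re ≤ M j)
    {B : ℝ} (hB : ∀ j ∈ cells, M j ≤ B) {μ : ℝ} (hμ : μ ∈ Set.Icc μlo μhi) {ω : InfVolFermionState 2}
    (hmin : ω.IsMeanEnergyMinimiser (hubbardTTPrimeMuInteraction 1 tp U μ) 1) :
    (ω.expect (pairRegion (insert (0 : Site 2) unitSteps) 0)
      (localPairAt (insert (0 : Site 2) unitSteps) dWaveFormFactor 0)).re ≤ B := by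
  obtain ⟨j, hj, hjμ⟩ := hcover μ hμ
  have hmin' : ω.IsMeanEnergyMinimiser (hubbardTTPrimeSourcedInteraction 1 tp U μ dWaveFormFactor 0) 1 := by
    rw [hubbardTTPrimeSourcedInteraction_zero_source]; exact hmin
  have hcapω := meanEnergy_sourced_grid_le_of_cell_max hU hmin' hjμ (hn0 j hj) (hn2 j hj)
  have he : ω.meanEnergy (hubbardTTPrimeSourcedInteraction 1 tp U (μg j) dWaveFormFactor 0) 1 ≤ ug j := by
    linarith [hug j hj, hhi j hj]
  exact (hcell j hj μ hjμ ω hmin' he).trans (hB j hj)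

/-- **Grand-canonical cells ⇒ `|ω(P₀^d)| ≤ B` for every translation-invariant ground state of `H^{tt'} − μN`, `μ` in the
bracket** (gauge rotation, as in part 3). [cite: KomaTasaki1994, §2.4] [cite: BratteliKishimotoRobinson1978, Thm. 2 (p. 47)] -/
theorem norm_expect_localPairAt_le_of_gcCells {tp U : ℝ} (hU : 0 ≤ U) {μlo μhi : ℝ}
    {J : Type*} (cells : Finset J) (μg Δg ug M n₀ hi : J → ℝ) (hn0 : ∀ j ∈ cells, 0 ≤ n₀ j)
    (hn2 : ∀ j ∈ cells, n₀ j < 2) (hhi : ∀ j ∈ cells, energyDensityTT' 1 tp U (n₀ j) ≤ hi j)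
    (hcover : ∀ μ ∈ Set.Icc μlo μhi, ∃ j ∈ cells, |μg j - μ| ≤ Δg j)
    (hug : ∀ j ∈ cells, hi j - μg j * n₀ j + Δg j * max (n₀ j) (2 - n₀ j) ≤ ug j)
    (hcell : ∀ j ∈ cells, ∀ μc : ℝ, |μg j - μc| ≤ Δg j → ∀ ω : InfVolFermionState 2,
      ω.IsMeanEnergyMinimiser (hubbardTTPrimeSourcedInteraction 1 tp U μc dWaveFormFactor 0) 1 →
      ω.meanEnergy (hubbardTTPrimeSourcedInteraction 1 tp U (μg j) dWaveFormFactor 0) 1 ≤ ug j →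
        (ω.expect (pairRegion (insert (0 : Site 2) unitSteps) 0)
          (localPairAt (insert (0 : Site 2) unitSteps) dWaveFormFactor 0)).re ≤ M j)
    {B : ℝ} (hB : ∀ j ∈ cells, M j ≤ B) {μ : ℝ} (hμ : μ ∈ Set.Icc μlo μhi) {ω : InfVolFermionState 2}
    (hmin : ω.IsMeanEnergyMinimiser (hubbardTTPrimeMuInteraction 1 tp U μ) 1) :
    ‖ω.expect (pairRegion (insert (0 : Site 2) unitSteps) 0)
      (localPairAt (insert (0 : Site 2) unitSteps) dWaveFormFactor 0)‖ ≤ B := by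
  set z : ℂ := ω.expect (pairRegion (insert (0 : Site 2) unitSteps) 0)
    (localPairAt (insert (0 : Site 2) unitSteps) dWaveFormFactor 0) with hz
  set θ : ℝ := Complex.arg z / 2 with hθ
  have hminθ : (ω.gaugeShift θ).IsMeanEnergyMinimiser (hubbardTTPrimeMuInteraction 1 tp U μ) 1 :=
    hmin.gaugeShift (hubbardTTPrimeMuInteraction_isGaugeInvariant 1 tp U μ) θ
  have hre := re_expect_localPairAt_le_of_gcCells hU cells μg Δg ug M n₀ hi hn0 hn2 hhi hcover hug hcell hB hμ hminθ
  have hrot : (ω.gaugeShift θ).expect (pairRegion (insert (0 : Site 2) unitSteps) 0)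
      (localPairAt (insert (0 : Site 2) unitSteps) dWaveFormFactor 0) = ((‖z‖ : ℝ) : ℂ) := by
    rw [InfVolFermionState.gaugeShift_expect_localPairAt, ← hz]
    have h1 : ((‖z‖ : ℝ) : ℂ) * Complex.exp ((Complex.arg z : ℂ) * I) = z := Complex.norm_mul_exp_arg_mul_I z
    have h2 : Complex.exp (-(2 * (I * (θ : ℂ)))) * Complex.exp ((Complex.arg z : ℂ) * I) = 1 := by
      rw [← Complex.exp_add, hθ, Complex.ofReal_div]
      have : -(2 * (I * ((Complex.arg z : ℂ) / (2 : ℕ)))) + (Complex.arg z : ℂ) * I = 0 := by push_cast; ring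
      rw [show ((2 : ℝ) : ℂ) = ((2 : ℕ) : ℂ) by norm_num, this, Complex.exp_zero]
    calc Complex.exp (-(2 * (I * (θ : ℂ)))) * z
        = Complex.exp (-(2 * (I * (θ : ℂ)))) * (((‖z‖ : ℝ) : ℂ) * Complex.exp ((Complex.arg z : ℂ) * I)) := by
          rw [h1]
      _ = ((‖z‖ : ℝ) : ℂ) * (Complex.exp (-(2 * (I * (θ : ℂ)))) * Complex.exp ((Complex.arg z : ℂ) * I)) := by
          ring
      _ = ((‖z‖ : ℝ) : ℂ) := by rw [h2, mul_one]
  rw [hrot, Complex.ofReal_re] at hre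
  exact hre

/-- **THE ORDER-PARAMETER CEILING.** Under the hypotheses of `re_expect_localPairAt_le_of_gcCells`, the Koma–Tasaki
quasi-average `d`-wave order parameter obeys **`m⋆(μ) = dWaveOrderParameterTT' t' U μ ≤ B` for EVERY `μ ∈ [μlo, μhi]`**:
`m⋆(μ) = −∂⁺_h E(μ,h)|₀ /2` is the pair amplitude of SOME translation-invariant ground state of `H^{tt'} − μN`
(`exists_isMeanEnergyMinimiser_two_mul_re_expect_localPairAt_eq_neg_rightDeriv`). This is the sentence a grand-canonical
one-point `μ`-cover would certify: a ceiling on the symmetry-breaking order parameter itself (pinning field `h → 0⁺`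
after `L → ∞`), on the whole chemical-potential bracket. [cite: KomaTasaki1994, §1] [cite: Griffiths1966, §II] -/
theorem dWaveOrderParameterTT'_le_of_gcCells {tp U : ℝ} (hU : 0 ≤ U) {μlo μhi : ℝ}
    {J : Type*} (cells : Finset J) (μg Δg ug M n₀ hi : J → ℝ) (hn0 : ∀ j ∈ cells, 0 ≤ n₀ j)
    (hn2 : ∀ j ∈ cells, n₀ j < 2) (hhi : ∀ j ∈ cells, energyDensityTT' 1 tp U (n₀ j) ≤ hi j)
    (hcover : ∀ μ ∈ Set.Icc μlo μhi, ∃ j ∈ cells, |μg j - μ| ≤ Δg j)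
    (hug : ∀ j ∈ cells, hi j - μg j * n₀ j + Δg j * max (n₀ j) (2 - n₀ j) ≤ ug j)
    (hcell : ∀ j ∈ cells, ∀ μc : ℝ, |μg j - μc| ≤ Δg j → ∀ ω : InfVolFermionState 2,
      ω.IsMeanEnergyMinimiser (hubbardTTPrimeSourcedInteraction 1 tp U μc dWaveFormFactor 0) 1 →
      ω.meanEnergy (hubbardTTPrimeSourcedInteraction 1 tp U (μg j) dWaveFormFactor 0) 1 ≤ ug j →
        (ω.expect (pairRegion (insert (0 : Site 2) unitSteps) 0)
          (localPairAt (insert (0 : Site 2) unitSteps) dWaveFormFactor 0)).re ≤ M j)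
    {B : ℝ} (hB : ∀ j ∈ cells, M j ≤ B) {μ : ℝ} (hμ : μ ∈ Set.Icc μlo μhi) :
    dWaveOrderParameterTT' tp U μ ≤ B := by
  obtain ⟨ω, hω, hωe⟩ := exists_isMeanEnergyMinimiser_two_mul_re_expect_localPairAt_eq_neg_rightDeriv tp U μ 0
  have hmin : ω.IsMeanEnergyMinimiser (hubbardTTPrimeMuInteraction 1 tp U μ) 1 := by
    rw [← hubbardTTPrimeSourcedInteraction_zero_source 1 tp U μ dWaveFormFactor]; exact hω
  have hre := re_expect_localPairAt_le_of_gcCells hU cells μg Δg ug M n₀ hi hn0 hn2 hhi hcover hug hcell hB hμ hmin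
  rw [dWaveOrderParameterTT'_eq_neg_half_rightDeriv]
  linarith

/-- **Ergodic translation-invariant ground states on the bracket obey the pair-LRO ceiling `B²` state by state** (any
density): `N⁻⁴ Σ_{x,y∈[0,N)²} ω(P_x^d⋆ P_y^d) → |ω(P₀^d)|² ≤ B²`, ε-eventually.
[cite: BratteliRobinsonI1987, Thm. 4.3.17] [cite: KomaTasaki1994, §2.4] -/
theorem boxPairLRO_le_of_isErgodic_gcCells {tp U : ℝ} (hU : 0 ≤ U) {μlo μhi : ℝ}
    {J : Type*} (cells : Finset J) (μg Δg ug M n₀ hi : J → ℝ) (hn0 : ∀ j ∈ cells, 0 ≤ n₀ j)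
    (hn2 : ∀ j ∈ cells, n₀ j < 2) (hhi : ∀ j ∈ cells, energyDensityTT' 1 tp U (n₀ j) ≤ hi j)
    (hcover : ∀ μ ∈ Set.Icc μlo μhi, ∃ j ∈ cells, |μg j - μ| ≤ Δg j)
    (hug : ∀ j ∈ cells, hi j - μg j * n₀ j + Δg j * max (n₀ j) (2 - n₀ j) ≤ ug j)
    (hcell : ∀ j ∈ cells, ∀ μc : ℝ, |μg j - μc| ≤ Δg j → ∀ ω : InfVolFermionState 2,
      ω.IsMeanEnergyMinimiser (hubbardTTPrimeSourcedInteraction 1 tp U μc dWaveFormFactor 0) 1 →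
      ω.meanEnergy (hubbardTTPrimeSourcedInteraction 1 tp U (μg j) dWaveFormFactor 0) 1 ≤ ug j →
        (ω.expect (pairRegion (insert (0 : Site 2) unitSteps) 0)
          (localPairAt (insert (0 : Site 2) unitSteps) dWaveFormFactor 0)).re ≤ M j)
    {B : ℝ} (hB : ∀ j ∈ cells, M j ≤ B) {μ : ℝ} (hμ : μ ∈ Set.Icc μlo μhi) {ω : InfVolFermionState 2}
    (herg : ω.IsErgodic) (hmin : ω.IsMeanEnergyMinimiser (hubbardTTPrimeMuInteraction 1 tp U μ) 1) (ε : ℝ)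
    (hε : 0 < ε) :
    ∀ᶠ N : ℕ in atTop,
      (((N : ℂ) ^ 4)⁻¹ * ∑ x ∈ halfOpenBox 2 N, ∑ y ∈ halfOpenBox 2 N, ω.dWavePairCorr x y).re ≤ B ^ 2 + ε := by
  have hlim := herg.tendsto_re_boxAverage_dWavePairCorr
  have hnorm := norm_expect_localPairAt_le_of_gcCells hU cells μg Δg ug M n₀ hi hn0 hn2 hhi hcover hug hcell hB hμ hmin
  have hsq : ‖ω.expect (pairRegion (insert (0 : Site 2) unitSteps) 0)
      (localPairAt (insert 0 unitSteps) dWaveFormFactor 0)‖ ^ 2 ≤ B ^ 2 :=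
    pow_le_pow_left₀ (norm_nonneg _) hnorm 2
  have hev := (tendsto_order.1 hlim).2 _ (lt_of_le_of_lt hsq (lt_add_of_pos_right _ hε))
  filter_upwards [hev] with N hN
  exact hN.le

end GCConsumers

/-! ### §5  The registry leaf from a grand-canonical cover (appended) -/

section GCLeaf

/-- **A grand-canonical cover also gives the registry leaf.** If the covered bracket contains the subdifferential
(`μlo ≤ μ₋(n)`, `μ₊(n) ≤ μhi`, certified chords; `U ≥ 0`, `0 < n < 2`), the grand-canonical cell sentences give
`ObsPairLROCeilingAt t' U n c'` for every rational `c' ≥ B²`, `B ≥ 0` — through hubbard-obs-gs-2's ground-state-complete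
reading (the tower witnesses' torus limits are translation-invariant minimisers of `H^{tt'} − μN`, `μ ∈ [μ₋(n), μ₊(n)]`). So an
OP1-GC cover is a strict superset product: the pair-LRO leaf AND the order-parameter ceiling `dWaveOrderParameterTT'_le_of_gcCells`.
[cite: KomaTasaki1994, Theorem 5] [cite: BratteliKishimotoRobinson1978, Thm. 2 (p. 47)] -/
theorem ObsPairLROCeilingAt_of_gcCells {tp U n : ℝ} (hU : 0 ≤ U) (hn0 : 0 < n) (hn2 : n < 2) {μlo μhi : ℝ}
    (hμlo : μlo ≤ chemPotMinusTT' 1 tp U n) (hμhi : chemPotPlusTT' 1 tp U n ≤ μhi)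
    {J : Type*} (cells : Finset J) (μg Δg ug M n₀ hi : J → ℝ) (hn0' : ∀ j ∈ cells, 0 ≤ n₀ j)
    (hn2' : ∀ j ∈ cells, n₀ j < 2) (hhi : ∀ j ∈ cells, energyDensityTT' 1 tp U (n₀ j) ≤ hi j)
    (hcover : ∀ μ ∈ Set.Icc μlo μhi, ∃ j ∈ cells, |μg j - μ| ≤ Δg j)
    (hug : ∀ j ∈ cells, hi j - μg j * n₀ j + Δg j * max (n₀ j) (2 - n₀ j) ≤ ug j)
    (hcell : ∀ j ∈ cells, ∀ μc : ℝ, |μg j - μc| ≤ Δg j → ∀ ω : InfVolFermionState 2,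
      ω.IsMeanEnergyMinimiser (hubbardTTPrimeSourcedInteraction 1 tp U μc dWaveFormFactor 0) 1 →
      ω.meanEnergy (hubbardTTPrimeSourcedInteraction 1 tp U (μg j) dWaveFormFactor 0) 1 ≤ ug j →
        (ω.expect (pairRegion (insert (0 : Site 2) unitSteps) 0)
          (localPairAt (insert (0 : Site 2) unitSteps) dWaveFormFactor 0)).re ≤ M j)
    {B : ℝ} (hB : ∀ j ∈ cells, M j ≤ B) {c' : ℚ} (hc' : B ^ 2 ≤ (c' : ℝ)) :
    ObsPairLROCeilingAt tp U n c' := by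
  refine ObsPairLROCeilingAt_of_groundState_onePoint_bound hU hn0 hn2 (M := B) ?_ hc'
  intro μ hμ ω _hTI _hρ hmin _hgs
  exact re_expect_localPairAt_le_of_gcCells hU cells μg Δg ug M n₀ hi hn0' hn2' hhi hcover hug hcell hB
    ⟨hμlo.trans hμ.1, hμ.2.trans hμhi⟩ hmin

end GCLeaf

end Summit.Ventures.CertifiedManyBodySolver.Observables


end
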